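import Summits.AnomalousDissipation.AnomalousDissipation.Theorems.SawtoothPulseCascadeK1LocalisedCascadeLedgerMajorants

/-!
# K1loc, line `Spectral` / SeqCone — helper: GEOMETRIC MAJORANTS OF THE CONCRETE HALF-SLOT ERRORS, II (sums and rates)

Helper file of the prover lane on the crux `K1LocalisedCascade` (stmt-AnomalousDissipation-19491), route
`SawtoothPulseCascade` (S-B/S-C assembly seat).  Companion of `…LedgerMajorants`: the eight term bounds are summed into
* `exists_errX_bound` — ONE constant `A ≥ 0`, independent of the phase `j`, the viscosity `κ` (`κ·r^{2j} ≤ 1`), the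
  flat-layer depth `M_j` (`≤ M̄(j+1)`), the envelope radius (`Rw·ε_j ≤ c`) and the slot clock, with
  `X_j ≤ A·(j+1)²Θ₀^j` for the amplitude error `X_j` of `…cascade_ledger_step_H/V_concrete` along the schedule;
* `exists_errY_bound` — the same for the energy error `Y_j` (moment terms `∝ c₂/b_j`, zone volumes `4M_jδ_j/π` with
  `δ_j = δ₀/2^j`, and their square roots);
* §3 the rate `Θ₀ = √(max(16/ρ, 1/2))` and `θ = √Θ₀`: `16/ρ ≤ Θ₀²`, `1/2 ≤ Θ₀²`, `0 ≤ Θ₀ < θ < 1` whenever `16 < ρ`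
  (on the schedule `ρ > γ² − 3 ≥ 22`).
No definitions; no statement about the stub. [cite: ElgindiLissMattingly2025, §1.2.1 and §3.1] [problem: turb]
-/

-- `Summit.<Summit>.<Problem>`: single-conjunct summit, the duplicate namespace segment is deliberate.
set_option linter.dupNamespace false

noncomputable section

namespace Summit.AnomalousDissipation.AnomalousDissipation.Theorems.SawtoothPulseCascade.K1Ledger

open Real

/-! ## §1 The amplitude error -/

/-- **Uniform geometric majorant of the amplitude error `X_j`.**  Static data: `γ, γ_b, L₀, δ₀ > 0`, non-negative
`C₁, C₂, Co, Cn, M̄, c`, rates `1 ≤ r`, `0 < ρ ≤ r²`, `0 ≤ Θ₀ ≤ 1` with `16/ρ ≤ Θ₀²`, `1/2 ≤ Θ₀²`.  Then ONE `A ≥ 0` bounds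
`X_j ≤ A(j+1)²Θ₀^j` for every phase `j`, viscosity `κ ≥ 0` with `κr^{2j} ≤ 1`, depth `0 ≤ M ≤ M̄(j+1)`, `M² ≤ M̄²(j+1)`,
envelope radius `Rw ≥ 0` with `Rw·ε_j ≤ c` (`ε_j = 1/(1000Γ^j)`, `Γ = (1+γ)²+1`), clock `tH ∈ [0,1]`, and cut-off
constants `c₁ = 2C₁(M+4)Λ_j`, `c₂ = (4C₂(M+4)²+2C₁(2M²+33))Λ_j²`, `Λ_j = (2π/δ₀)4^j`.
[cite: ElgindiLissMattingly2025, §1.2.1 and §3.1] -/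
theorem exists_errX_bound {γ γb L₀ δ₀ C₁ C₂ Co Cn Mb r ρ Θ₀ c : ℝ}
    (hγ : 0 < γ) (hγb : 0 < γb) (hL₀ : 0 < L₀) (hδ₀ : 0 < δ₀) (hC₁ : 0 ≤ C₁) (hC₂ : 0 ≤ C₂) (hCo : 0 ≤ Co)
    (hCn : 0 ≤ Cn) (hMb : 0 ≤ Mb) (hc : 0 ≤ c) (hr : 1 ≤ r) (hρ : 0 < ρ) (hρr : ρ ≤ r ^ 2) (hΘ0 : 0 ≤ Θ₀)
    (hΘ1 : Θ₀ ≤ 1) (h16 : 16 / ρ ≤ Θ₀ ^ 2) (hhalf : 1 / 2 ≤ Θ₀ ^ 2) (hΓ : 2 ≤ (1 + γ) ^ 2 + 1) :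
    ∃ A : ℝ, 0 ≤ A ∧ ∀ (j : ℕ) (κ M Rw tH c₁ c₂ : ℝ), 0 ≤ κ → κ * r ^ (2 * j) ≤ 1 → 0 ≤ M →
      M ≤ Mb * ((j : ℝ) + 1) → M ^ 2 ≤ Mb ^ 2 * ((j : ℝ) + 1) → 0 ≤ Rw →
      Rw * (1 / (1000 * ((1 + γ) ^ 2 + 1) ^ j)) ≤ c →
      0 ≤ tH → tH ≤ 1 → c₁ = 2 * C₁ * (M + 4) * (2 * Real.pi / δ₀ * 4 ^ j) →
      c₂ = (4 * C₂ * (M + 4) ^ 2 + 2 * C₁ * (2 * M ^ 2 + 33)) * (2 * Real.pi / δ₀ * 4 ^ j) ^ 2 →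
      Real.sqrt 2 * (Co / (L₀ * ρ ^ j / (20 * γb * (1 + 1 / 250))) * (c₂ / (4 * Real.pi * Real.sqrt 3))) +
        Real.sqrt 2 * (2 * κ * tH * c₂ + 4 * c₁ * Real.sqrt (κ * tH / 2) +
            Real.sqrt (γ * (2 * (2 * (1 / (1000 * ((1 + γ) ^ 2 + 1) ^ j)))) * (5 + 6 * c₁ ^ 2 * κ * tH)) +
            Co / (L₀ * ρ ^ j / (20 * γb * (1 + 1 / 250))) *
              ((c₂ + 2 * Real.pi * c₁ + Real.pi ^ 2) / (2 * Real.sqrt 3 * (2 * Real.pi))) +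
            Co / (L₀ * ρ ^ j / (20 * γb * (1 + 1 / 250))) * ((2 * Real.pi * Rw *
                (γ * ((2 + 8 * C₁) * (M + 4) * (2 * Real.pi / δ₀ * 4 ^ j) *
                  (3 * (1 / (1000 * ((1 + γ) ^ 2 + 1) ^ j))))) +
              (2 * Real.pi * Rw * (γ * (2 * (3 * (1 / (1000 * ((1 + γ) ^ 2 + 1) ^ j)))))) ^ 2) /
                (4 * Real.pi * Real.sqrt 3)) +
          Real.sqrt (2 * (Cn / (L₀ * ρ ^ j / (20 * γb * (1 + 1 / 250))) *
            ((c₂ + 2 * Real.pi * c₁ + Real.pi ^ 2) / (2 * Real.sqrt 3 * (2 * Real.pi)))))) ≤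
        A * (((j : ℝ) + 1) ^ 2 * Θ₀ ^ j) := by
  -- static constants
  set cb : ℝ := 20 * γb * (1 + 1 / 250) / L₀ with hcb
  set cc₁ : ℝ := 2 * C₁ * (Mb + 4) * (2 * Real.pi / δ₀) with hcc₁
  set cc₂ : ℝ := (4 * C₂ * (Mb + 4) ^ 2 + 2 * C₁ * (2 * Mb ^ 2 + 33)) * (2 * Real.pi / δ₀) ^ 2 with hcc₂
  set E2 : ℝ := 2 * Real.pi * c * (γ * ((2 + 8 * C₁) * (Mb + 4) * (2 * Real.pi / δ₀) * 3)) with hE2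
  set E1 : ℝ := 2 * Real.pi * c * (γ * 6) with hE1
  have hcb0 : 0 < cb := by positivity
  have hcc₁0 : 0 ≤ cc₁ := by positivity
  have hcc₂0 : 0 ≤ cc₂ := by positivity
  have hE20 : 0 ≤ E2 := by positivity
  have hE10 : 0 ≤ E1 := by positivity
  set A1 : ℝ := Co * cb * (cc₂ / (4 * Real.pi * Real.sqrt 3)) with hA1
  set A2 : ℝ := 2 * cc₂ with hA2
  set A3 : ℝ := 4 * cc₁ with hA3
  set A4 : ℝ := Real.sqrt (γ * (4 / 1000) * (5 + 6 * cc₁ ^ 2)) with hA4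
  set A5 : ℝ := Co * cb * ((cc₂ + 2 * Real.pi * cc₁ + Real.pi ^ 2) / (2 * Real.sqrt 3 * (2 * Real.pi))) with hA5
  set A6 : ℝ := Co * cb * ((E2 + E1 ^ 2) / (4 * Real.pi * Real.sqrt 3)) with hA6
  set A8 : ℝ := Real.sqrt (2 * (Cn * cb * ((cc₂ + 2 * Real.pi * cc₁ + Real.pi ^ 2) /
      (2 * Real.sqrt 3 * (2 * Real.pi))))) with hA8
  refine ⟨Real.sqrt 2 * A1 + Real.sqrt 2 * (A2 + A3 + A4 + A5 + A6 + A8), by positivity, ?_⟩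
  intro j κ M Rw tH c₁ c₂ hκ hκr hM hMle hM2le hRw hRwε htH0 htH1 hc₁ hc₂
  have hΘj : 0 ≤ Θ₀ ^ j := pow_nonneg hΘ0 j
  have hΦ0 : 0 ≤ ((j : ℝ) + 1) ^ 2 * Θ₀ ^ j := by positivity
  -- the cut-off constants and the `κ`-facts of this phase
  have hc₁0 : 0 ≤ c₁ := by rw [hc₁]; positivity
  have hc₂0 : 0 ≤ c₂ := by rw [hc₂]; positivity
  have hc₁le : c₁ ≤ cc₁ * (((j : ℝ) + 1) * 4 ^ j) := by rw [hc₁]; exact c_one_le hC₁ hδ₀ j hMle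
  have hc₂le : c₂ ≤ cc₂ * (((j : ℝ) + 1) ^ 2 * 16 ^ j) := by rw [hc₂]; exact c_two_le hC₁ hC₂ hδ₀ j hM hMle hM2le
  have hκ16 := kappa_mul_pow_le hr hρ hρr h16 j hκr
  have hκ4 := sqrt_kappa_mul_pow_le hκ hΘ0 hr hρ hρr h16 j hκr
  -- the eight terms
  have hT1 := fibre_term_le hL₀ hρ hγb hCo (D := 4 * Real.pi * Real.sqrt 3) (by positivity) j
    (c_two_div_le hρ hΘ0 hΘ1 h16 hcc₂0 j hc₂le)
  have hT2 := term_two_le hκ htH1 hΘ0 hΘ1 hcc₂0 j hc₂0 hc₂le hκ16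
  have hT3 := term_three_le hκ htH1 hcc₁0 j hc₁le hκ4
  have hT4 := term_four_le hγ.le hΓ hκ htH0 htH1 hΘ0 hΘ1 hhalf j hc₁0 hc₁le hκ16
  have hT5 := fibre_term_le hL₀ hρ hγb hCo (D := 2 * Real.sqrt 3 * (2 * Real.pi)) (by positivity) j
    ((c_sum_div_le hρ h16 hcc₁0 hcc₂0 j hc₁le hc₂le).trans (mul_le_mul_of_nonneg_left
      (mul_le_mul_of_nonneg_left (pow_sq_le_pow hΘ0 hΘ1 j) (by positivity)) (by positivity)))
  have hT6 := fibre_term_le hL₀ hρ hγb hCo (D := 4 * Real.pi * Real.sqrt 3) (by positivity) j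
    (twist_terms_le (cRL := c) hγ.le hδ₀ hC₁ hMb hρ hΘ0 hΘ1 h16 j hM hMle hRw (by positivity) hRwε)
  have hT8 := term_eight_le hL₀ hρ hγb hCn hΘ0 h16 hcc₁0 hcc₂0 j hc₁le hc₂le
  -- sum
  have hs2 : 0 ≤ Real.sqrt 2 := Real.sqrt_nonneg _
  have hsum := add_le_add (add_le_add (add_le_add (add_le_add (add_le_add hT2 hT3) hT4) hT5) hT6) hT8
  have key : ∀ a2 a3 a4 a5 a6 a8 Φ : ℝ,
      a2 * Φ + a3 * Φ + a4 * Φ + a5 * Φ + a6 * Φ + a8 * Φ = (a2 + a3 + a4 + a5 + a6 + a8) * Φ := by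
    intros; ring
  have key2 : ∀ a s Φ : ℝ, Real.sqrt 2 * (a * Φ) + Real.sqrt 2 * (s * Φ) = (Real.sqrt 2 * a + Real.sqrt 2 * s) * Φ := by
    intros; ring
  exact (add_le_add (mul_le_mul_of_nonneg_left hT1 hs2)
    (mul_le_mul_of_nonneg_left (hsum.trans (le_of_eq (key _ _ _ _ _ _ _))) hs2)).trans (le_of_eq (key2 _ _ _))


/-! ## §2 The energy error -/

/-- **Uniform geometric majorant of the energy error `Y_j`** (`E₀ = ‖θ₀‖²`, `B = sup|θ₀|`, zone volume `4M_jδ_j/π` with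
`δ_j = δ₀/2^j`, `wd₂`-moments `∝ c₂/b_j`). [cite: ElgindiLissMattingly2025, §1 (corner strips) and §3.1] -/
theorem exists_errY_bound {γb L₀ δ₀ C₁ C₂ Cn Mb ρ Θ₀ E₀ B : ℝ}
    (hγb : 0 < γb) (hL₀ : 0 < L₀) (hδ₀ : 0 < δ₀) (hC₁ : 0 ≤ C₁) (hC₂ : 0 ≤ C₂) (hCn : 0 ≤ Cn) (hMb : 0 ≤ Mb)
    (hρ : 0 < ρ) (hΘ0 : 0 ≤ Θ₀) (hΘ1 : Θ₀ ≤ 1) (h16 : 16 / ρ ≤ Θ₀ ^ 2) (hhalf : 1 / 2 ≤ Θ₀ ^ 2) (hE₀ : 0 ≤ E₀)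
    (hB : 0 ≤ B) :
    ∃ A : ℝ, 0 ≤ A ∧ ∀ (j : ℕ) (M c₂ : ℝ), 0 ≤ M → M ≤ Mb * ((j : ℝ) + 1) → M ^ 2 ≤ Mb ^ 2 * ((j : ℝ) + 1) →
      c₂ = (4 * C₂ * (M + 4) ^ 2 + 2 * C₁ * (2 * M ^ 2 + 33)) * (2 * Real.pi / δ₀ * 4 ^ j) ^ 2 →
      2 * (Cn / (L₀ * ρ ^ j / (20 * γb * (1 + 1 / 250))) * (c₂ / (4 * Real.pi * Real.sqrt 3)) * E₀) +
        (B ^ 2 * (4 * M * (δ₀ / 2 ^ j) / Real.pi) +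
          2 * (Cn / (L₀ * ρ ^ j / (20 * γb * (1 + 1 / 250))) * ((c₂ + c₂) / (4 * Real.pi * Real.sqrt 3)) * E₀ +
            Real.sqrt E₀ * ((B / 4) * Real.sqrt (4 * M * (δ₀ / 2 ^ j) / Real.pi)))) ≤
        A * (((j : ℝ) + 1) ^ 2 * Θ₀ ^ j) := by
  set cb : ℝ := 20 * γb * (1 + 1 / 250) / L₀ with hcb
  set cc₂ : ℝ := (4 * C₂ * (Mb + 4) ^ 2 + 2 * C₁ * (2 * Mb ^ 2 + 33)) * (2 * Real.pi / δ₀) ^ 2 with hcc₂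
  have hcb0 : 0 < cb := by positivity
  have hcc₂0 : 0 ≤ cc₂ := by positivity
  refine ⟨2 * (Cn * cb * (cc₂ / (4 * Real.pi * Real.sqrt 3))) * E₀ + (B ^ 2 * (4 * Mb * δ₀ / Real.pi) +
    2 * ((Cn * cb * (2 * cc₂ / (4 * Real.pi * Real.sqrt 3))) * E₀ + Real.sqrt E₀ * ((B / 4) *
      Real.sqrt (4 * Mb * δ₀ / Real.pi)))), by positivity, ?_⟩
  intro j M c₂ hM hMle hM2le hc₂
  have hj1 : (1 : ℝ) ≤ (j : ℝ) + 1 := by have : (0 : ℝ) ≤ j := Nat.cast_nonneg j; linarith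
  have hj2 : (j : ℝ) + 1 ≤ ((j : ℝ) + 1) ^ 2 := le_self_pow₀ hj1 (by norm_num)
  have hΘj : 0 ≤ Θ₀ ^ j := pow_nonneg hΘ0 j
  have hΦ0 : 0 ≤ ((j : ℝ) + 1) ^ 2 * Θ₀ ^ j := by positivity
  have h2j : (0 : ℝ) < 2 ^ j := by positivity
  -- the moment terms
  have hc₂le : c₂ ≤ cc₂ * (((j : ℝ) + 1) ^ 2 * 16 ^ j) := by rw [hc₂]; exact c_two_le hC₁ hC₂ hδ₀ j hM hMle hM2le
  have hS := c_two_div_le hρ hΘ0 hΘ1 h16 hcc₂0 j hc₂le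
  have hT1 := fibre_term_le hL₀ hρ hγb hCn (D := 4 * Real.pi * Real.sqrt 3) (by positivity) j hS
  have hS2 : (c₂ + c₂) * (ρ ^ j)⁻¹ ≤ 2 * cc₂ * (((j : ℝ) + 1) ^ 2 * Θ₀ ^ j) := by
    have : (c₂ + c₂) * (ρ ^ j)⁻¹ = 2 * (c₂ * (ρ ^ j)⁻¹) := by ring
    rw [this, mul_assoc]; exact mul_le_mul_of_nonneg_left hS (by norm_num)
  have hT2 := fibre_term_le hL₀ hρ hγb hCn (D := 4 * Real.pi * Real.sqrt 3) (by positivity) j hS2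
  -- the zone terms: `M δ₀/2^j ≤ M̄ δ₀ (((j : ℝ) + 1) ^ 2 * Θ₀ ^ j)` and its square root
  have hhalfΘ : 1 / 2 ≤ Θ₀ := hhalf.trans (pow_le_of_le_one hΘ0 hΘ1 (by norm_num))
  have hpow : (1 / 2 : ℝ) ^ j ≤ Θ₀ ^ j := pow_le_pow_left₀ (by norm_num) hhalfΘ j
  have hpow2 : (1 / 2 : ℝ) ^ j ≤ (Θ₀ ^ j) ^ 2 := by
    rw [← pow_mul, mul_comm, pow_mul]; exact pow_le_pow_left₀ (by norm_num) hhalf j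
  have hMδ : M * (δ₀ / 2 ^ j) ≤ Mb * δ₀ * (((j : ℝ) + 1) ^ 2 * Θ₀ ^ j) := by
    calc M * (δ₀ / 2 ^ j) = M * δ₀ * (1 / 2) ^ j := by rw [one_div, inv_pow]; field_simp
      _ ≤ Mb * ((j : ℝ) + 1) * δ₀ * Θ₀ ^ j := by gcongr
      _ ≤ Mb * ((j : ℝ) + 1) ^ 2 * δ₀ * Θ₀ ^ j := by gcongr
      _ = Mb * δ₀ * (((j : ℝ) + 1) ^ 2 * Θ₀ ^ j) := by ring
  have hZ1 : B ^ 2 * (4 * M * (δ₀ / 2 ^ j) / Real.pi) ≤ B ^ 2 * (4 * Mb * δ₀ / Real.pi) * (((j : ℝ) + 1) ^ 2 * Θ₀ ^ j) := by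
    have hπ := Real.pi_pos
    calc B ^ 2 * (4 * M * (δ₀ / 2 ^ j) / Real.pi) = B ^ 2 * (4 / Real.pi) * (M * (δ₀ / 2 ^ j)) := by ring
      _ ≤ B ^ 2 * (4 / Real.pi) * (Mb * δ₀ * (((j : ℝ) + 1) ^ 2 * Θ₀ ^ j)) := mul_le_mul_of_nonneg_left hMδ (by positivity)
      _ = B ^ 2 * (4 * Mb * δ₀ / Real.pi) * (((j : ℝ) + 1) ^ 2 * Θ₀ ^ j) := by ring
  have hZ2 : Real.sqrt (4 * M * (δ₀ / 2 ^ j) / Real.pi) ≤ Real.sqrt (4 * Mb * δ₀ / Real.pi) * (((j : ℝ) + 1) ^ 2 * Θ₀ ^ j) := by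
    have hπ := Real.pi_pos
    have hrad : 4 * M * (δ₀ / 2 ^ j) / Real.pi ≤ (Real.sqrt (4 * Mb * δ₀ / Real.pi) * (((j : ℝ) + 1) * Θ₀ ^ j)) ^ 2 := by
      rw [mul_pow, Real.sq_sqrt (by positivity)]
      calc 4 * M * (δ₀ / 2 ^ j) / Real.pi = 4 / Real.pi * (M * δ₀) * (1 / 2) ^ j := by
            rw [one_div, inv_pow]; field_simp
        _ ≤ 4 / Real.pi * (Mb * ((j : ℝ) + 1) * δ₀) * (Θ₀ ^ j) ^ 2 := by gcongr
        _ ≤ 4 / Real.pi * (Mb * ((j : ℝ) + 1) ^ 2 * δ₀) * (Θ₀ ^ j) ^ 2 := by gcongr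
        _ = 4 * Mb * δ₀ / Real.pi * (((j : ℝ) + 1) * Θ₀ ^ j) ^ 2 := by ring
    calc Real.sqrt (4 * M * (δ₀ / 2 ^ j) / Real.pi) ≤ Real.sqrt (4 * Mb * δ₀ / Real.pi) * (((j : ℝ) + 1) * Θ₀ ^ j) :=
          Real.sqrt_le_iff.2 ⟨by positivity, hrad⟩
      _ ≤ Real.sqrt (4 * Mb * δ₀ / Real.pi) * (((j : ℝ) + 1) ^ 2 * Θ₀ ^ j) :=
          mul_le_mul_of_nonneg_left (mul_le_mul_of_nonneg_right hj2 hΘj) (Real.sqrt_nonneg _)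
  -- sum
  have hsE : 0 ≤ Real.sqrt E₀ := Real.sqrt_nonneg _
  have e1 : 2 * (Cn / (L₀ * ρ ^ j / (20 * γb * (1 + 1 / 250))) * (c₂ / (4 * Real.pi * Real.sqrt 3)) * E₀) ≤
      2 * (Cn * cb * (cc₂ / (4 * Real.pi * Real.sqrt 3))) * E₀ * (((j : ℝ) + 1) ^ 2 * Θ₀ ^ j) := by
    have := mul_le_mul_of_nonneg_right hT1 hE₀
    calc 2 * (Cn / (L₀ * ρ ^ j / (20 * γb * (1 + 1 / 250))) * (c₂ / (4 * Real.pi * Real.sqrt 3)) * E₀)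
        ≤ 2 * (Cn * cb * (cc₂ / (4 * Real.pi * Real.sqrt 3)) * (((j : ℝ) + 1) ^ 2 * Θ₀ ^ j) * E₀) :=
          mul_le_mul_of_nonneg_left this (by norm_num)
      _ = 2 * (Cn * cb * (cc₂ / (4 * Real.pi * Real.sqrt 3))) * E₀ * (((j : ℝ) + 1) ^ 2 * Θ₀ ^ j) := by ring
  have e2 : 2 * (Cn / (L₀ * ρ ^ j / (20 * γb * (1 + 1 / 250))) * ((c₂ + c₂) / (4 * Real.pi * Real.sqrt 3)) * E₀ +
      Real.sqrt E₀ * ((B / 4) * Real.sqrt (4 * M * (δ₀ / 2 ^ j) / Real.pi))) ≤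
      2 * ((Cn * cb * (2 * cc₂ / (4 * Real.pi * Real.sqrt 3))) * E₀ * (((j : ℝ) + 1) ^ 2 * Θ₀ ^ j) +
        Real.sqrt E₀ * ((B / 4) * (Real.sqrt (4 * Mb * δ₀ / Real.pi) * (((j : ℝ) + 1) ^ 2 * Θ₀ ^ j)))) := by
    have h1 := mul_le_mul_of_nonneg_right hT2 hE₀
    have h2 := mul_le_mul_of_nonneg_left (mul_le_mul_of_nonneg_left hZ2 (by positivity : (0 : ℝ) ≤ B / 4)) hsE
    have h3 := mul_le_mul_of_nonneg_left (add_le_add h1 h2) (by norm_num : (0 : ℝ) ≤ 2)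
    refine h3.trans (le_of_eq ?_)
    ring
  calc _ ≤ 2 * (Cn * cb * (cc₂ / (4 * Real.pi * Real.sqrt 3))) * E₀ * (((j : ℝ) + 1) ^ 2 * Θ₀ ^ j) + (B ^ 2 * (4 * Mb * δ₀ / Real.pi) * (((j : ℝ) + 1) ^ 2 * Θ₀ ^ j) +
        2 * ((Cn * cb * (2 * cc₂ / (4 * Real.pi * Real.sqrt 3))) * E₀ * (((j : ℝ) + 1) ^ 2 * Θ₀ ^ j) +
          Real.sqrt E₀ * ((B / 4) * (Real.sqrt (4 * Mb * δ₀ / Real.pi) * (((j : ℝ) + 1) ^ 2 * Θ₀ ^ j))))) := add_le_add e1 (add_le_add hZ1 e2)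
    _ = _ := by ring

/-! ## §3 The rate `Θ₀ = √(max(16/ρ, 1/2))` and `θ = √Θ₀` -/

/-- `Θ₀² = max(16/ρ, 1/2)`. [folklore] -/
theorem theta0_sq (ρ : ℝ) : Real.sqrt (max (16 / ρ) (1 / 2)) ^ 2 = max (16 / ρ) (1 / 2) :=
  Real.sq_sqrt ((show (0 : ℝ) ≤ 1 / 2 by norm_num).trans (le_max_right _ _))

/-- `16/ρ ≤ Θ₀²` and `1/2 ≤ Θ₀²`. [folklore] -/
theorem le_theta0_sq (ρ : ℝ) :
    16 / ρ ≤ Real.sqrt (max (16 / ρ) (1 / 2)) ^ 2 ∧ 1 / 2 ≤ Real.sqrt (max (16 / ρ) (1 / 2)) ^ 2 := by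
  rw [theta0_sq]; exact ⟨le_max_left _ _, le_max_right _ _⟩

/-- `0 < Θ₀ < 1` for `16 < ρ`. [folklore] -/
theorem theta0_pos_lt_one {ρ : ℝ} (hρ : 16 < ρ) :
    0 < Real.sqrt (max (16 / ρ) (1 / 2)) ∧ Real.sqrt (max (16 / ρ) (1 / 2)) < 1 := by
  have hm0 : 0 < max (16 / ρ) (1 / 2) := lt_max_of_lt_right (by norm_num)
  have hm1 : max (16 / ρ) (1 / 2) < 1 := max_lt ((div_lt_one (by linarith)).2 hρ) (by norm_num)
  refine ⟨Real.sqrt_pos.2 hm0, ?_⟩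
  exact (Real.sqrt_lt_sqrt hm0.le hm1).trans_eq Real.sqrt_one

/-- `Θ₀ < θ = √Θ₀ < 1` and `0 ≤ θ` for `16 < ρ` (the final rate absorbs the polynomial losses). [folklore] -/
theorem theta_facts {ρ : ℝ} (hρ : 16 < ρ) :
    Real.sqrt (max (16 / ρ) (1 / 2)) < Real.sqrt (Real.sqrt (max (16 / ρ) (1 / 2))) ∧
    Real.sqrt (Real.sqrt (max (16 / ρ) (1 / 2))) < 1 ∧ 0 ≤ Real.sqrt (Real.sqrt (max (16 / ρ) (1 / 2))) := by
  obtain ⟨h0, h1⟩ := theta0_pos_lt_one hρ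
  refine ⟨?_, ?_, Real.sqrt_nonneg _⟩
  · -- `Θ₀ < √Θ₀` since `Θ₀² < Θ₀`
    have h : Real.sqrt (max (16 / ρ) (1 / 2)) ^ 2 < Real.sqrt (max (16 / ρ) (1 / 2)) := by nlinarith
    calc Real.sqrt (max (16 / ρ) (1 / 2)) = Real.sqrt (Real.sqrt (max (16 / ρ) (1 / 2)) ^ 2) := by
          rw [Real.sqrt_sq h0.le]
      _ < Real.sqrt (Real.sqrt (max (16 / ρ) (1 / 2))) := Real.sqrt_lt_sqrt (sq_nonneg _) h
  · exact (Real.sqrt_lt_sqrt h0.le h1).trans_eq Real.sqrt_one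

end Summit.AnomalousDissipation.AnomalousDissipation.Theorems.SawtoothPulseCascade.K1Ledger
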